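import Summits.Ventures.LatticeQCDFlow.Exactness.Phi4HMCExact
import HarnessLib

/-!
# The HMC update of lattice φ⁴ is reversible: detailed balance of the configuration chain, integrated form

HONEST FRAMING: exact (Metropolis-corrected) sampling algorithms for lattice gauge theory;
figures of merit are autocorrelation/cost numbers at stated couplings and volumes; no
continuum-physics claim.  (SCALAR calibration rung S0-A: not a gauge result.)

Venture `LatticeQCDFlow` (cell pub-lqcd), topic `Exactness`; FANOUT row 2 (`s0-phi4`: the HMC arm
of the 2D φ⁴ calibration; the exactness battery's detailed-balance legs T2a/T2c).  NEW WORK of the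
cell over Mathlib; nothing is cited as a fact.  Printed counterparts, named only:
Duane–Kennedy–Pendleton–Roweth 1987, Neal 2011 §5.3 (HMC with full momentum refresh and the
momentum flip is reversible with respect to the target of the positions).

Relation to the tree.  `Exactness/InvolutiveMetropolis.lean` (row 30) proves reversibility of the
deterministic-proposal kernel on PHASE SPACE as a Mathlib `Kernel.IsReversible`;
`Exactness/Phi4HMCExact.lean` (row 2) proves that the HMC update of the CONFIGURATION
(`hmcOpOf`: refresh `p ∼ N(0,1)^Λ`, propose `Ψ(φ,p)`, Metropolis test, else stay) is exact.  Here: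
that configuration update is SELF-ADJOINT on `L²(e^{−S}dφ)` — detailed balance of the chain the
battery scores, in the same integrated form, for bounded observables.

## What is proved

* §1 (measure space `(X, μ)`, measurable `H`, `Ψ` a measurable `μ`-preserving involution).
  `abs_involOp_le` (`|f| ≤ B ⇒ |involOp f| ≤ B`), `measurable_involOp`;
  **`integral_involAccept_comp_mul_symm`** — for ANY `g`, `h`:
  `∫ a·(g∘Ψ)·h·e^{−H} dμ = ∫ a·g·(h∘Ψ)·e^{−H} dμ` (the symmetrised weight `min(e^{−H}, e^{−H∘Ψ})`
  is `Ψ`-invariant; substitution along `Ψ`); **`involOp_symm`** — `e^{−H}` integrable, `g`, `h`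
  bounded measurable: `∫ (involOp g)·h·e^{−H} dμ = ∫ g·(involOp h)·e^{−H} dμ`.
* §2 (lattice `Fin (n+1) → ℝ`).  `integrable_exp_neg_phi4HmcEnergy` (coercive action: `e^{−H}` is
  integrable on phase space); `hmcOpOf_pairing` — `∫ (K_Ψ f) g e^{−S} dφ =
  Z_p⁻¹ ∫∫ involOp(f∘fst)·(g∘fst)·e^{−H} dφ dp` (Fubini); **`hmc_reversible_of_involutive`** —
  for EVERY measurable Lebesgue-preserving involution `Ψ` of phase space, coercive `S`, bounded
  measurable `f`, `g`: `∫ (K_Ψ f)·g·e^{−S} dφ = ∫ f·(K_Ψ g)·e^{−S} dφ`; instances **`hmc_reversible`**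
  (the engine's qpq leapfrog, every `δ`, `N`), `hmcPQP_reversible` (pqp), and
  **`hmc_reversible_phi4`** — EVERY `λ > 0`, EVERY real `J`, EVERY `δ`, `N`:
  `⟨(K f) g⟩ = ⟨f (K g)⟩` in the φ⁴ Gibbs law.  (Exactness is the case `g = 1`:
  `Phi4HMCExact.hmc_exact`.)

NOT CLAIMED: spectral gap / geometric ergodicity; anything for observables that are not bounded
(the moments are covered by exactness, `hmc_exact_monomial`, not by this file).
-/

namespace Summit.Ventures.LatticeQCDFlow.Exactness

open Real MeasureTheory Finset Filter
open Summit.Ventures.LatticeQCDFlow.Scoring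

/-! ## §1 The involutive Metropolis step is self-adjoint -/

section General

variable {X : Type*} [MeasurableSpace X] {μ : Measure X}

omit [MeasurableSpace X] in
/-- `involOp` is a pointwise convex combination: `|f| ≤ B ⇒ |involOp H Ψ f| ≤ B`. -/
theorem abs_involOp_le (H : X → ℝ) (Ψ : X → X) {f : X → ℝ} {B : ℝ} (hfb : ∀ z, |f z| ≤ B)
    (z : X) : |involOp H Ψ f z| ≤ B := by
  have ha0 := involAccept_nonneg H Ψ z
  have ha1 := involAccept_le_one H Ψ z
  unfold involOp
  calc |involAccept H Ψ z * f (Ψ z) + (1 - involAccept H Ψ z) * f z|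
      ≤ |involAccept H Ψ z * f (Ψ z)| + |(1 - involAccept H Ψ z) * f z| := abs_add_le _ _
    _ = involAccept H Ψ z * |f (Ψ z)| + (1 - involAccept H Ψ z) * |f z| := by
        rw [abs_mul, abs_mul, abs_of_nonneg ha0, abs_of_nonneg (sub_nonneg.mpr ha1)]
    _ ≤ involAccept H Ψ z * B + (1 - involAccept H Ψ z) * B :=
        add_le_add (mul_le_mul_of_nonneg_left (hfb _) ha0)
          (mul_le_mul_of_nonneg_left (hfb _) (sub_nonneg.mpr ha1))
    _ = B := by ring

/-- `involOp` maps measurable observables to measurable ones. -/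
theorem measurable_involOp {H : X → ℝ} {Ψ : X → X} (hH : Measurable H) (hΨ : Measurable Ψ)
    {f : X → ℝ} (hf : Measurable f) : Measurable (involOp H Ψ f) := by
  unfold involOp
  exact ((measurable_involAccept hH hΨ).mul (hf.comp hΨ)).add
    ((measurable_const.sub (measurable_involAccept hH hΨ)).mul hf)

/-- A bounded measurable function times an integrable weight is integrable. -/
theorem integrable_bdd_mul_weight {φ w : X → ℝ} (hφm : Measurable φ) {C : ℝ} (hφb : ∀ z, |φ z| ≤ C)
    (hwm : Measurable w) (hw0 : ∀ z, 0 ≤ w z) (hwi : Integrable w μ) :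
    Integrable (fun z => φ z * w z) μ := by
  refine Integrable.mono' (hwi.const_mul C) (hφm.mul hwm).aestronglyMeasurable
    (Eventually.of_forall fun z => ?_)
  rw [Real.norm_eq_abs, abs_mul, abs_of_nonneg (hw0 z)]
  exact mul_le_mul_of_nonneg_right (hφb z) (hw0 z)

/-- **The swap**: for a measurable `μ`-preserving involution `Ψ` and ANY `g`, `h`,
`∫ a(z) g(Ψ z) h(z) e^{−H z} dμ = ∫ a(z) g(z) h(Ψ z) e^{−H z} dμ`. -/
theorem integral_involAccept_comp_mul_symm {H : X → ℝ} {Ψ : X → X} (hΨm : Measurable Ψ)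
    (hΨi : Function.Involutive Ψ) (hΨμ : MeasurePreserving Ψ μ μ) (g h : X → ℝ) :
    ∫ z, involAccept H Ψ z * g (Ψ z) * h z * Real.exp (-H z) ∂μ
      = ∫ z, involAccept H Ψ z * g z * h (Ψ z) * Real.exp (-H z) ∂μ := by
  set m : X → ℝ := fun z => min (Real.exp (-H z)) (Real.exp (-H (Ψ z))) with hm
  have hmΨ : ∀ z, m (Ψ z) = m z := fun z => by
    simp only [hm, hΨi z, min_comm]
  have h1 : ∀ z, involAccept H Ψ z * g (Ψ z) * h z * Real.exp (-H z)
      = (fun y => m y * g y * h (Ψ y)) (Ψ z) := by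
    intro z
    show _ = m (Ψ z) * g (Ψ z) * h (Ψ (Ψ z))
    rw [hmΨ z, hΨi z]
    simp only [hm]
    rw [← exp_neg_mul_involAccept]
    ring
  have h2 : ∀ z, involAccept H Ψ z * g z * h (Ψ z) * Real.exp (-H z) = m z * g z * h (Ψ z) := by
    intro z
    simp only [hm]
    rw [← exp_neg_mul_involAccept]
    ring
  simp_rw [h1, h2]
  exact hΨμ.integral_comp (MeasurableEquiv.ofInvolutive Ψ hΨi hΨm).measurableEmbedding
    (fun y => m y * g y * h (Ψ y))

/-- **`involOp` IS SELF-ADJOINT ON `L²(e^{−H}μ)`** (detailed balance, integrated form): for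
`e^{−H}` integrable and bounded measurable `g`, `h`,
`∫ (involOp H Ψ g)·h·e^{−H} dμ = ∫ g·(involOp H Ψ h)·e^{−H} dμ`. -/
theorem involOp_symm {H : X → ℝ} {Ψ : X → X} (hH : Measurable H) (hΨm : Measurable Ψ)
    (hΨi : Function.Involutive Ψ) (hΨμ : MeasurePreserving Ψ μ μ)
    (hw : Integrable (fun z => Real.exp (-H z)) μ) {g h : X → ℝ} (hgm : Measurable g)
    (hhm : Measurable h) {Bg Bh : ℝ} (hgb : ∀ z, |g z| ≤ Bg) (hhb : ∀ z, |h z| ≤ Bh) :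
    ∫ z, involOp H Ψ g z * h z * Real.exp (-H z) ∂μ
      = ∫ z, g z * involOp H Ψ h z * Real.exp (-H z) ∂μ := by
  have hwm : Measurable fun z => Real.exp (-H z) := Real.measurable_exp.comp hH.neg
  have hw0 : ∀ z, 0 ≤ Real.exp (-H z) := fun z => (Real.exp_pos _).le
  have ham := measurable_involAccept hH hΨm
  have ha_bd : ∀ z, |involAccept H Ψ z| ≤ 1 := fun z => by
    rw [abs_of_nonneg (involAccept_nonneg H Ψ z)]
    exact involAccept_le_one H Ψ z
  have h1a_bd : ∀ z, |1 - involAccept H Ψ z| ≤ 1 := fun z => by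
    rw [abs_of_nonneg (by linarith [involAccept_le_one H Ψ z])]
    linarith [involAccept_nonneg H Ψ z]
  -- the four pieces are bounded measurable times the weight, hence integrable
  have hI1 : Integrable (fun z => involAccept H Ψ z * g (Ψ z) * h z * Real.exp (-H z)) μ := by
    refine integrable_bdd_mul_weight ((ham.mul (hgm.comp hΨm)).mul hhm) (C := Bg * Bh)
      (fun z => ?_) hwm hw0 hw
    have hBg : 0 ≤ Bg := (abs_nonneg _).trans (hgb z)
    rw [abs_mul, abs_mul]
    calc |involAccept H Ψ z| * |g (Ψ z)| * |h z| ≤ 1 * Bg * Bh := by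
          gcongr
          · exact ha_bd z
          · exact hgb _
          · exact hhb _
      _ = Bg * Bh := by ring
  have hI2 : Integrable (fun z => (1 - involAccept H Ψ z) * g z * h z * Real.exp (-H z)) μ := by
    refine integrable_bdd_mul_weight (((measurable_const.sub ham).mul hgm).mul hhm) (C := Bg * Bh)
      (fun z => ?_) hwm hw0 hw
    have hBg : 0 ≤ Bg := (abs_nonneg _).trans (hgb z)
    rw [abs_mul, abs_mul]
    calc |1 - involAccept H Ψ z| * |g z| * |h z| ≤ 1 * Bg * Bh := by
          gcongr
          · exact h1a_bd z
          · exact hgb _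
          · exact hhb _
      _ = Bg * Bh := by ring
  have hI3 : Integrable (fun z => involAccept H Ψ z * g z * h (Ψ z) * Real.exp (-H z)) μ := by
    refine integrable_bdd_mul_weight ((ham.mul hgm).mul (hhm.comp hΨm)) (C := Bg * Bh)
      (fun z => ?_) hwm hw0 hw
    have hBg : 0 ≤ Bg := (abs_nonneg _).trans (hgb z)
    rw [abs_mul, abs_mul]
    calc |involAccept H Ψ z| * |g z| * |h (Ψ z)| ≤ 1 * Bg * Bh := by
          gcongr
          · exact ha_bd z
          · exact hgb _
          · exact hhb _
      _ = Bg * Bh := by ring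
  have hL : ∀ z, involOp H Ψ g z * h z * Real.exp (-H z)
      = involAccept H Ψ z * g (Ψ z) * h z * Real.exp (-H z)
        + (1 - involAccept H Ψ z) * g z * h z * Real.exp (-H z) := by
    intro z
    simp only [involOp]
    ring
  have hR : ∀ z, g z * involOp H Ψ h z * Real.exp (-H z)
      = involAccept H Ψ z * g z * h (Ψ z) * Real.exp (-H z)
        + (1 - involAccept H Ψ z) * g z * h z * Real.exp (-H z) := by
    intro z
    simp only [involOp]
    ring
  simp_rw [hL, hR]
  rw [integral_add hI1 hI2, integral_add hI3 hI2, integral_involAccept_comp_mul_symm hΨm hΨi hΨμ g h]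

end General

/-! ## §2 The HMC update of the configuration is reversible for `e^{−S} dφ` -/

section Lattice

variable {n : ℕ}

/-- Under a coercive action the phase-space weight `e^{−H}` is integrable
(`= e^{−S(φ)} e^{−½Σp²}`, `exp_neg_phi4HmcEnergy`). -/
theorem integrable_exp_neg_phi4HmcEnergy {J : Fin (n + 1) → Fin (n + 1) → ℝ} {lam ε K : ℝ}
    (hε : 0 < ε) (hS : ∀ φ : Fin (n + 1) → ℝ, ε * ∑ w, φ w ^ 2 - K ≤ latticePhi4Action J lam φ) :
    Integrable (fun z => Real.exp (-phi4HmcEnergy J lam z))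
      ((volume : Measure (Fin (n + 1) → ℝ)).prod volume) := by
  refine ((integrable_gibbsWeight_of_coercive hε hS).mul_prod integrable_momentumWeight).congr
    (Eventually.of_forall fun z => ?_)
  exact (exp_neg_phi4HmcEnergy J lam z).symm

/-- **The pairing through phase space** (Fubini): for bounded measurable `f`, `g` and a coercive
action, `∫ (K_Ψ f)(φ) g(φ) e^{−S(φ)} dφ = Z_p⁻¹ ∫∫ (involOp H Ψ (f∘fst))(z) g(z.1) e^{−H(z)} dz`. -/
theorem hmcOpOf_pairing {J : Fin (n + 1) → Fin (n + 1) → ℝ} {lam ε K : ℝ} (hε : 0 < ε)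
    (hS : ∀ φ : Fin (n + 1) → ℝ, ε * ∑ w, φ w ^ 2 - K ≤ latticePhi4Action J lam φ)
    {Ψ : (Fin (n + 1) → ℝ) × (Fin (n + 1) → ℝ) → (Fin (n + 1) → ℝ) × (Fin (n + 1) → ℝ)}
    (hΨm : Measurable Ψ) {f g : (Fin (n + 1) → ℝ) → ℝ} (hfm : Measurable f) (hgm : Measurable g)
    {Bf Bg : ℝ} (hfb : ∀ φ, |f φ| ≤ Bf) (hgb : ∀ φ, |g φ| ≤ Bg) :
    ∫ φ, hmcOpOf J lam Ψ f φ * g φ * gibbsWeight J lam φ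
      = (∫ z, involOp (phi4HmcEnergy J lam) Ψ (fun y => f y.1) z * g z.1
          * Real.exp (-phi4HmcEnergy J lam z)
            ∂((volume : Measure (Fin (n + 1) → ℝ)).prod volume)) / momentumZ n := by
  set H := phi4HmcEnergy J lam with hH
  set F : (Fin (n + 1) → ℝ) × (Fin (n + 1) → ℝ) → ℝ := fun y => f y.1 with hF
  have hHm : Measurable H := measurable_phi4HmcEnergy J lam
  have hFm : Measurable F := hfm.comp measurable_fst
  have hFb : ∀ z, |F z| ≤ Bf := fun z => hfb z.1
  have hW : ∀ φ p, Real.exp (-H (φ, p)) = gibbsWeight J lam φ * momentumWeight p :=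
    fun φ p => exp_neg_phi4HmcEnergy J lam (φ, p)
  -- integrability of the phase-space integrand
  have hint : Integrable (fun z => involOp H Ψ F z * g z.1 * Real.exp (-H z))
      ((volume : Measure (Fin (n + 1) → ℝ)).prod volume) := by
    refine integrable_bdd_mul_weight ((measurable_involOp hHm hΨm hFm).mul (hgm.comp measurable_fst))
      (C := Bf * Bg) (fun z => ?_) (Real.measurable_exp.comp hHm.neg) (fun z => (Real.exp_pos _).le)
      (integrable_exp_neg_phi4HmcEnergy hε hS)
    have hBf : 0 ≤ Bf := (abs_nonneg _).trans (hfb z.1)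
    rw [abs_mul]
    exact mul_le_mul (abs_involOp_le H Ψ hFb z) (hgb z.1) (abs_nonneg _) hBf
  have hop : ∀ φ, hmcOpOf J lam Ψ f φ
      = (∫ p, involOp H Ψ F (φ, p) * momentumWeight p) / momentumZ n := fun φ => rfl
  have hfub : ∫ φ, (∫ p, involOp H Ψ F (φ, p) * momentumWeight p) * g φ * gibbsWeight J lam φ
      = ∫ z, involOp H Ψ F z * g z.1 * Real.exp (-H z)
          ∂((volume : Measure (Fin (n + 1) → ℝ)).prod volume) := by
    rw [integral_prod _ hint]
    refine integral_congr_ae (Eventually.of_forall fun φ => ?_)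
    dsimp only
    rw [mul_assoc, ← integral_mul_const]
    refine integral_congr_ae (Eventually.of_forall fun p => ?_)
    dsimp only
    rw [hW φ p]
    ring
  calc ∫ φ, hmcOpOf J lam Ψ f φ * g φ * gibbsWeight J lam φ
      = ∫ φ, ((∫ p, involOp H Ψ F (φ, p) * momentumWeight p) * g φ * gibbsWeight J lam φ)
          / momentumZ n := by
        refine integral_congr_ae (Eventually.of_forall fun φ => ?_)
        dsimp only
        rw [hop]
        ring
    _ = (∫ z, involOp H Ψ F z * g z.1 * Real.exp (-H z)
          ∂((volume : Measure (Fin (n + 1) → ℝ)).prod volume)) / momentumZ n := by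
        rw [integral_div, hfub]

/-- **THE HMC-TYPE UPDATE IS REVERSIBLE FOR `e^{−S} dφ`** — for EVERY measurable Lebesgue-preserving
involution `Ψ` of phase space, every coercive action (`λ > 0` and any `J`, or a positive-definite
free field) and all bounded measurable `f`, `g`:
`∫ (K_Ψ f)·g·e^{−S} dφ = ∫ f·(K_Ψ g)·e^{−S} dφ` (detailed balance, integrated form). -/
theorem hmc_reversible_of_involutive {J : Fin (n + 1) → Fin (n + 1) → ℝ} {lam ε K : ℝ}
    (hε : 0 < ε) (hS : ∀ φ : Fin (n + 1) → ℝ, ε * ∑ w, φ w ^ 2 - K ≤ latticePhi4Action J lam φ)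
    {Ψ : (Fin (n + 1) → ℝ) × (Fin (n + 1) → ℝ) → (Fin (n + 1) → ℝ) × (Fin (n + 1) → ℝ)}
    (hΨm : Measurable Ψ) (hΨi : Function.Involutive Ψ)
    (hΨμ : MeasurePreserving Ψ ((volume : Measure (Fin (n + 1) → ℝ)).prod volume)
      ((volume : Measure (Fin (n + 1) → ℝ)).prod volume))
    {f g : (Fin (n + 1) → ℝ) → ℝ} (hfm : Measurable f) (hgm : Measurable g) {Bf Bg : ℝ}
    (hfb : ∀ φ, |f φ| ≤ Bf) (hgb : ∀ φ, |g φ| ≤ Bg) :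
    ∫ φ, hmcOpOf J lam Ψ f φ * g φ * gibbsWeight J lam φ
      = ∫ φ, f φ * hmcOpOf J lam Ψ g φ * gibbsWeight J lam φ := by
  have hHm : Measurable (phi4HmcEnergy J lam) := measurable_phi4HmcEnergy J lam
  have hsym := involOp_symm (μ := (volume : Measure (Fin (n + 1) → ℝ)).prod volume) hHm hΨm hΨi
    hΨμ (integrable_exp_neg_phi4HmcEnergy hε hS)
    (g := fun y : (Fin (n + 1) → ℝ) × (Fin (n + 1) → ℝ) => f y.1)
    (h := fun y : (Fin (n + 1) → ℝ) × (Fin (n + 1) → ℝ) => g y.1)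
    (hfm.comp measurable_fst) (hgm.comp measurable_fst)
    (Bg := Bf) (Bh := Bg) (fun z => hfb z.1) (fun z => hgb z.1)
  have hrhs : ∫ φ, f φ * hmcOpOf J lam Ψ g φ * gibbsWeight J lam φ
      = ∫ φ, hmcOpOf J lam Ψ g φ * f φ * gibbsWeight J lam φ := by
    refine integral_congr_ae (Eventually.of_forall fun φ => ?_)
    dsimp only
    ring
  rw [hrhs, hmcOpOf_pairing hε hS hΨm hfm hgm hfb hgb, hmcOpOf_pairing hε hS hΨm hgm hfm hgb hfb]
  congr 1
  rw [hsym]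
  refine integral_congr_ae (Eventually.of_forall fun z => ?_)
  dsimp only
  ring

/-- **The engine's HMC update (qpq leapfrog, every `δ`, `N`) is reversible** under a coercive action. -/
theorem hmc_reversible {J : Fin (n + 1) → Fin (n + 1) → ℝ} {lam ε K : ℝ} (hε : 0 < ε)
    (hS : ∀ φ : Fin (n + 1) → ℝ, ε * ∑ w, φ w ^ 2 - K ≤ latticePhi4Action J lam φ)
    (δ : ℝ) (N : ℕ) {f g : (Fin (n + 1) → ℝ) → ℝ} (hfm : Measurable f) (hgm : Measurable g)
    {Bf Bg : ℝ} (hfb : ∀ φ, |f φ| ≤ Bf) (hgb : ∀ φ, |g φ| ≤ Bg) :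
    ∫ φ, hmcOpPhi4 J lam δ N f φ * g φ * gibbsWeight J lam φ
      = ∫ φ, f φ * hmcOpPhi4 J lam δ N g φ * gibbsWeight J lam φ :=
  hmc_reversible_of_involutive hε hS (measurable_hmcProposal J lam δ N)
    (hmcProposal_involutive J lam δ N) (measurePreserving_hmcProposal J lam δ N) hfm hgm hfb hgb

/-- The pqp-integrator update is reversible as well. -/
theorem hmcPQP_reversible {J : Fin (n + 1) → Fin (n + 1) → ℝ} {lam ε K : ℝ} (hε : 0 < ε)
    (hS : ∀ φ : Fin (n + 1) → ℝ, ε * ∑ w, φ w ^ 2 - K ≤ latticePhi4Action J lam φ)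
    (δ : ℝ) (N : ℕ) {f g : (Fin (n + 1) → ℝ) → ℝ} (hfm : Measurable f) (hgm : Measurable g)
    {Bf Bg : ℝ} (hfb : ∀ φ, |f φ| ≤ Bf) (hgb : ∀ φ, |g φ| ≤ Bg) :
    ∫ φ, hmcOpPQP J lam δ N f φ * g φ * gibbsWeight J lam φ
      = ∫ φ, f φ * hmcOpPQP J lam δ N g φ * gibbsWeight J lam φ :=
  hmc_reversible_of_involutive hε hS (measurable_hmcProposalPQP J lam δ N)
    (hmcProposalPQP_involutive J lam δ N) (measurePreserving_hmcProposalPQP J lam δ N)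
    hfm hgm hfb hgb

/-- **Every `λ > 0`, every real `J`, every `δ`, `N`**: `⟨(K f) g⟩ = ⟨f (K g)⟩` in the φ⁴ Gibbs
law — the HMC chain of the S0-A calibration satisfies detailed balance. -/
theorem hmc_reversible_phi4 {lam : ℝ} (hlam : 0 < lam) (J : Fin (n + 1) → Fin (n + 1) → ℝ)
    (δ : ℝ) (N : ℕ) {f g : (Fin (n + 1) → ℝ) → ℝ} (hfm : Measurable f) (hgm : Measurable g)
    {Bf Bg : ℝ} (hfb : ∀ φ, |f φ| ≤ Bf) (hgb : ∀ φ, |g φ| ≤ Bg) :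
    gibbsExpect J lam (fun φ => hmcOpPhi4 J lam δ N f φ * g φ)
      = gibbsExpect J lam (fun φ => f φ * hmcOpPhi4 J lam δ N g φ) := by
  unfold gibbsExpect
  rw [hmc_reversible one_pos (latticePhi4Action_coercive hlam J) δ N hfm hgm hfb hgb]

end Lattice

end Summit.Ventures.LatticeQCDFlow.Exactness
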